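import Mathlib
import Summits.ValiantsHypothesis.ValiantsHypothesis.Theses.GrenetZeon
import Summits.ValiantsHypothesis.ValiantsHypothesis.Theorems.GrenetZeonTwoDimCoefficientsDefs
import Summits.ValiantsHypothesis.ValiantsHypothesis.Theorems.GrenetZeonTwoDimCoefficientsStubClassify
import Summits.ValiantsHypothesis.ValiantsHypothesis.Theorems.GrenetZeonTwoDimCoefficientsStubSplitCase
import Summits.ValiantsHypothesis.ValiantsHypothesis.Theorems.GrenetZeonTwoDimCoefficientsStubDualCase
import Summits.ValiantsHypothesis.ValiantsHypothesis.Theorems.GrenetZeonHessianRankCodimTwo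
import Literature.Computability.AlgebraicComplexity.AlgDetRepr
import Literature.Computability.AlgebraicComplexity.StandardFamilies
import Literature.Computability.AlgebraicComplexity.LandsbergRessayreNormalForm
import HarnessLib

/-!
# Crux `GrenetZeon.PolySizeQPAlgebra` (stmt-ValiantsHypothesis-8064), line `vbp-slice-dealg` —
# the HOMOGENEOUS CORNER `m = n`: homogenization at the degree floor, and the `(n, 2)` point of the
# `c = 1` box is EMPTY

The piece `PolySizeQPAlgebra` at `c = 1` excludes, for large `n`, every `(m, s)`-representation of
`per_n` with `m ≤ n + 1` and `s ≤ 2 · 2^(log₂ n)`.  By the degree floor (`le_of_hasAlgDetRepr_perPoly`,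
`GrenetZeonPolySizeQPAlgebraDegreeFloor.lean`) only `m ∈ {n, n + 1}` can occur.  Decided so far: `s = 1`
(Mignon–Ressayre), the diagonal slice (`GrenetZeonPolySizeQPAlgebraLongDiagonal.lean`).  This file
decides the first OFF-DIAGONAL point with `s ≥ 2`:

* `homogeneousComponent_det_of_totalDegree_le_one` — **homogenization at the degree floor**, over ANY
  commutative ring: for an affine `k × k` matrix `A` (entries of total degree `≤ 1`), the degree-`k`
  homogeneous component of `det A` is `det L`, `L = A.map (homogeneousComponent 1)` the matrix of
  LINEAR PARTS (Leibniz expansion; lower components of one factor cannot be compensated).  Hence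
  (`exists_homogeneous_repr_of_isHomogeneous`) a form of degree `k` with a `(k, s)`-representation has
  one with HOMOGENEOUS LINEAR entries over the same coefficient algebra and functional — the normal
  form of the corner `m = deg f` of the two-parameter chart (for `per_n`: `m = n`).
* `homogeneousComponent_trace_adjugate_mul` — the same for the dual jet:
  `(tr(adj A · B))_k = tr(adj L_A · L_B)` (`tr(adj M · N) = Σ_j det(M with column j from N)`).
* `splitRepr_homogeneous` / `dualRepr_homogeneous` — at `m = n` the SPLIT shape
  `per_n = α det A + β det B` and the DUAL shape `per_n = α det A + β tr(adj A · B)` of an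
  `(n, ≤ 2)`-representation (`stub_classify`) may be taken with `A`, `B` homogeneous linear.
* `not_hasDim2Repr_self` / `not_hasAlgDetRepr_perPoly_self_two` — **THE `(n, 2)` CORNER IS EMPTY**:
  `∃ n₀, ∀ n ≥ n₀, ¬ HasAlgDetRepr (perPoly (Fin n) ℂ) n 2`.  Proof: after homogenization the origin
  is a common zero of `per_n` and `det A` (`A(0) = 0`), so the proved codimension-two Hessian point
  (`hessianRankCodimTwo_proof`, stmt-8061) supplies a common zero `p` with `n² < 2·rank Hess per_n(p)`,
  while `rank Hess per_n(p) ≤ 4n` (split, `rank_hess0_transl_perPoly_le_of_split`) resp. `≤ 6n` (dual,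
  `rank_hess0_transl_perPoly_le_of_dual`): `n < 12`.  The UNIT CASE of crux `TwoDimCoefficients`
  (stmt-8062: `det A ≡ c ≠ 0`, the open stub `stub_dualUnipotent`) cannot arise for a homogeneous
  witness — so `TwoDimCoefficients` holds at `m = n` outright (`twoDimCoefficients_self`).
* `polySizeQPAlgebra_one_point_two` — the reading for the piece: the point `(m, s) = (n, 2)` of the
  `c = 1` box carries no representation of `per_n` for large `n`.

Honest framing: one more decided point of the `c = 1` box (`(n, 2)`; the points `(n + 1, 2)` and
`(n, s)` with `3 ≤ s ≤ 2n` stay open — the first is the unit case of stmt-8062, the second is beyond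
the two-summand Hessian mechanism); the registered stubs `stub_vbpSlice` / `stub_dealgebraizePoly`
(`c ≥ 2`) are open-problem grade and untouched; nothing here bears on VP ≠ VNP.  Axioms `propext`,
`Classical.choice`, `Quot.sound`.

References: T. Mignon, N. Ressayre, *A quadratic bound for the determinant and permanent problem*,
IMRN 2004:79, §2 (Hessian of a determinant at a singular point); the tree's `HessianRankCodimTwo`
(stmt-ValiantsHypothesis-8061).
-/

set_option linter.dupNamespace false

noncomputable section

namespace Summit.ValiantsHypothesis.ValiantsHypothesis.Theorems.GrenetZeonPolySizeQPAlgebra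

open MvPolynomial Matrix
open Literature.Computability.AlgebraicComplexity
open Summit.ValiantsHypothesis.ValiantsHypothesis.Theses.GrenetZeon
open Summit.ValiantsHypothesis.ValiantsHypothesis.Cruxes.TwoDimCoefficients.DimTwoCases

/-! ### Homogeneous components of products of affine forms (any commutative ring) -/

section Homogenize

variable {σ : Type*} {S : Type*} [CommRing S]

/-- Top components multiply, with degree BOUNDS: if `deg u ≤ a` and `deg v ≤ b` then
`(u v)_{a+b} = u_a · v_b` (a lower component of one factor would need a component above the bound of
the other). [folklore] -/
theorem homogeneousComponent_mul_of_le {u v : MvPolynomial σ S} {a b : ℕ}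
    (hu : u.totalDegree ≤ a) (hv : v.totalDegree ≤ b) :
    homogeneousComponent (a + b) (u * v) = homogeneousComponent a u * homogeneousComponent b v := by
  classical
  ext d
  rw [coeff_homogeneousComponent, coeff_mul, coeff_mul]
  split_ifs with hd
  · refine Finset.sum_congr rfl fun x hx => ?_
    rw [Finset.HasAntidiagonal.mem_antidiagonal] at hx
    rw [coeff_homogeneousComponent, coeff_homogeneousComponent]
    have hdeg : x.1.degree + x.2.degree = a + b := by rw [← map_add, hx, hd]
    by_cases h1 : x.1.degree = a
    · have h2 : x.2.degree = b := by omega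
      rw [if_pos h1, if_pos h2]
    · rw [if_neg h1]
      rcases Nat.lt_or_gt_of_ne h1 with hlt | hgt
      · have h2 : v.totalDegree < x.2.degree := by omega
        have hv0 : coeff x.2 v = 0 :=
          coeff_eq_zero_of_totalDegree_lt (by rw [← Finsupp.degree_apply]; exact h2)
        rw [hv0, mul_zero, zero_mul]
      · have h1' : u.totalDegree < x.1.degree := by omega
        have hu0 : coeff x.1 u = 0 :=
          coeff_eq_zero_of_totalDegree_lt (by rw [← Finsupp.degree_apply]; exact h1')
        rw [hu0, zero_mul, zero_mul]
  · symm
    refine Finset.sum_eq_zero fun x hx => ?_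
    rw [Finset.HasAntidiagonal.mem_antidiagonal] at hx
    rw [coeff_homogeneousComponent, coeff_homogeneousComponent]
    split_ifs with h1 h2
    · exfalso
      apply hd
      rw [← hx, map_add, h1, h2]
    · rw [mul_zero]
    · rw [zero_mul]
    · rw [zero_mul]

/-- The top component of a product of affine forms is the product of their linear parts:
`(∏_{i ∈ s} p_i)_{|s|} = ∏_{i ∈ s} (p_i)_1` when every `deg p_i ≤ 1`. [folklore] -/
theorem homogeneousComponent_prod_of_totalDegree_le_one {ι : Type*} (s : Finset ι)
    (p : ι → MvPolynomial σ S) (hp : ∀ i ∈ s, (p i).totalDegree ≤ 1) :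
    homogeneousComponent s.card (∏ i ∈ s, p i) = ∏ i ∈ s, homogeneousComponent 1 (p i) := by
  classical
  induction s using Finset.induction_on with
  | empty => simp [homogeneousComponent_zero]
  | insert a s ha ih =>
    have hs : ∀ i ∈ s, (p i).totalDegree ≤ 1 := fun i hi => hp i (Finset.mem_insert_of_mem hi)
    have hdeg : (∏ i ∈ s, p i).totalDegree ≤ s.card := by
      refine (totalDegree_finsetProd s p).trans ?_
      calc ∑ i ∈ s, (p i).totalDegree ≤ ∑ _i ∈ s, 1 := Finset.sum_le_sum hs
        _ = s.card := by simp
    rw [Finset.prod_insert ha, Finset.prod_insert ha, Finset.card_insert_of_notMem ha, add_comm,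
      homogeneousComponent_mul_of_le (hp a (Finset.mem_insert_self a s)) hdeg, ih hs]

/-- **Homogenization at the degree floor.** For an affine square matrix `A` over `S[x]` (entries of
total degree `≤ 1`), the degree-`|m|` component of `det A` is the determinant of the matrix of linear
parts `A.map (homogeneousComponent 1)`. [folklore] -/
theorem homogeneousComponent_det_of_totalDegree_le_one {m : Type*} [Fintype m] [DecidableEq m]
    (A : Matrix m m (MvPolynomial σ S)) (hA : ∀ i j, (A i j).totalDegree ≤ 1) :
    homogeneousComponent (Fintype.card m) A.det = (A.map (homogeneousComponent 1)).det := by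
  rw [Matrix.det_apply, Matrix.det_apply, map_sum]
  refine Finset.sum_congr rfl fun τ _ => ?_
  rw [Units.smul_def, Units.smul_def, map_zsmul, ← Finset.card_univ,
    homogeneousComponent_prod_of_totalDegree_le_one _ _ fun i _ => hA _ _]
  simp only [Matrix.map_apply]

/-- `Fin k` form of `homogeneousComponent_det_of_totalDegree_le_one`. [folklore] -/
theorem homogeneousComponent_det_fin {k : ℕ} (A : Matrix (Fin k) (Fin k) (MvPolynomial σ S))
    (hA : ∀ i j, (A i j).totalDegree ≤ 1) :
    homogeneousComponent k A.det = (A.map (homogeneousComponent 1)).det := by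
  have h := homogeneousComponent_det_of_totalDegree_le_one A hA
  rwa [Fintype.card_fin] at h

/-- `tr(adj M · N) = Σ_j det (M with its j-th column replaced by that of N)` (Cramer). [folklore] -/
theorem trace_adjugate_mul_eq_sum_det_updateCol {m : Type*} [Fintype m] [DecidableEq m]
    {T : Type*} [CommRing T] (M N : Matrix m m T) :
    (M.adjugate * N).trace = ∑ j, (M.updateCol j fun i => N i j).det := by
  simp only [← Matrix.cramer_apply, Matrix.cramer_eq_adjugate_mulVec, Matrix.trace, Matrix.diag,
    Matrix.mul_apply, Matrix.mulVec, dotProduct]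

/-- Taking linear parts commutes with replacing a column. [folklore] -/
theorem map_updateCol_homogeneousComponent {m : Type*} [DecidableEq m]
    (A : Matrix m m (MvPolynomial σ S)) (j : m) (c : m → MvPolynomial σ S) :
    (A.updateCol j c).map (homogeneousComponent 1) =
      (A.map (homogeneousComponent 1)).updateCol j fun i => homogeneousComponent 1 (c i) := by
  ext i j'
  simp only [Matrix.map_apply, Matrix.updateCol_apply]
  split_ifs <;> rfl

/-- **Homogenization of the dual jet.** For affine square matrices `A`, `B`, the degree-`k` component
of `tr(adj A · B)` is `tr(adj L_A · L_B)` for the matrices of linear parts. [folklore] -/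
theorem homogeneousComponent_trace_adjugate_mul {k : ℕ}
    (A B : Matrix (Fin k) (Fin k) (MvPolynomial σ S))
    (hA : ∀ i j, (A i j).totalDegree ≤ 1) (hB : ∀ i j, (B i j).totalDegree ≤ 1) :
    homogeneousComponent k (A.adjugate * B).trace =
      ((A.map (homogeneousComponent 1)).adjugate * B.map (homogeneousComponent 1)).trace := by
  rw [trace_adjugate_mul_eq_sum_det_updateCol, trace_adjugate_mul_eq_sum_det_updateCol, map_sum]
  refine Finset.sum_congr rfl fun j _ => ?_
  rw [homogeneousComponent_det_fin _ (fun i j' => ?_), map_updateCol_homogeneousComponent]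
  · rfl
  · rw [Matrix.updateCol_apply]
    split_ifs
    · exact hB i j
    · exact hA i j'

/-- Entries of the matrix of linear parts are linear forms. [folklore] -/
theorem isHomogeneous_map_homogeneousComponent_one {m : Type*} (A : Matrix m m (MvPolynomial σ S))
    (i j : m) : ((A.map (homogeneousComponent 1)) i j).IsHomogeneous 1 := by
  rw [Matrix.map_apply]
  exact homogeneousComponent_isHomogeneous 1 _

/-- A form of degree `a` is its own degree-`a` component and has no other component. [folklore] -/
theorem homogeneousComponent_eq_of_isHomogeneous {φ : MvPolynomial σ S} {a : ℕ}
    (hφ : φ.IsHomogeneous a) (n : ℕ) : homogeneousComponent n φ = if n = a then φ else 0 :=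
  homogeneousComponent_of_mem ((mem_homogeneousSubmodule a φ).2 hφ)

/-- Linear forms have total degree `≤ 1`. [folklore] -/
theorem totalDegree_le_one_of_isHomogeneous_one {φ : MvPolynomial σ S} (hφ : φ.IsHomogeneous 1) :
    φ.totalDegree ≤ 1 := by
  by_cases h : φ = 0
  · rw [h, totalDegree_zero]; exact Nat.zero_le _
  · exact (hφ.totalDegree h).le

/-- Linear forms vanish at the origin. [folklore] -/
theorem constantCoeff_eq_zero_of_isHomogeneous_one {φ : MvPolynomial σ S} (hφ : φ.IsHomogeneous 1) :
    constantCoeff φ = 0 := by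
  change coeff 0 φ = 0
  exact hφ.coeff_eq_zero (by simp)

/-- The determinant of a square matrix of linear forms of positive size vanishes at the origin.
[folklore] -/
theorem constantCoeff_det_eq_zero_of_isHomogeneous_one {k : ℕ} (hk : 1 ≤ k)
    (A : Matrix (Fin k) (Fin k) (MvPolynomial σ S)) (hA : ∀ i j, (A i j).IsHomogeneous 1) :
    constantCoeff A.det = 0 := by
  rw [RingHom.map_det]
  haveI : Nonempty (Fin k) := ⟨⟨0, hk⟩⟩
  have h0 : (constantCoeff : MvPolynomial σ S →+* S).mapMatrix A = 0 := by
    ext i j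
    rw [RingHom.mapMatrix_apply, Matrix.map_apply, Matrix.zero_apply]
    exact constantCoeff_eq_zero_of_isHomogeneous_one (hA i j)
  rw [h0]
  exact Matrix.det_zero

end Homogenize

/-! ### Homogeneous normal form of `(deg f, s)`-representations -/

section Repr

universe u

variable {k : Type u} [CommRing k] {σ : Type*}

/-- **The corner `m = deg f` is homogeneous.** If a form `f` of degree `n` has an
`(n, s)`-representation, then it has one with HOMOGENEOUS LINEAR entries over the same kind of
coefficient algebra: replace every entry by its linear part (the degree-`n` coefficients of `det A`
only see linear parts, `homogeneousComponent_det_fin`; all other coefficients of `f` vanish).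
[folklore] -/
theorem exists_homogeneous_repr_of_isHomogeneous {f : MvPolynomial σ k} {n s : ℕ}
    (hf : f.IsHomogeneous n) (h : HasAlgDetRepr f n s) :
    ∃ (R : Type u) (_ : CommRing R) (_ : Algebra k R) (_ : Module.Finite k R),
      Module.finrank k R ≤ s ∧ ∃ (l : R →ₗ[k] k) (A : Matrix (Fin n) (Fin n) (MvPolynomial σ R)),
        (∀ i j, (A i j).IsHomogeneous 1) ∧
          ∀ d : σ →₀ ℕ, l (MvPolynomial.coeff d A.det) = MvPolynomial.coeff d f := by
  obtain ⟨R, _, _, _, hR, l, A, hA, hcoeff⟩ := h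
  refine ⟨R, inferInstance, inferInstance, inferInstance, hR, l, A.map (homogeneousComponent 1),
    isHomogeneous_map_homogeneousComponent_one A, fun d => ?_⟩
  rw [← homogeneousComponent_det_fin A hA, coeff_homogeneousComponent]
  split_ifs with hd
  · exact hcoeff d
  · rw [map_zero, hf.coeff_eq_zero hd]

/-- Conversely a homogeneous witness is a witness: `HasAlgDetRepr` from homogeneous data.
[folklore] -/
theorem hasAlgDetRepr_of_homogeneous_data {f : MvPolynomial σ k} {n s : ℕ} (R : Type u) [CommRing R]
    [Algebra k R] [Module.Finite k R] (hR : Module.finrank k R ≤ s) (l : R →ₗ[k] k)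
    (A : Matrix (Fin n) (Fin n) (MvPolynomial σ R)) (hA : ∀ i j, (A i j).IsHomogeneous 1)
    (hf : ∀ d : σ →₀ ℕ, l (MvPolynomial.coeff d A.det) = MvPolynomial.coeff d f) :
    HasAlgDetRepr f n s :=
  HasAlgDetRepr.of_data R hR l A (fun i j => totalDegree_le_one_of_isHomogeneous_one (hA i j)) hf

end Repr

/-! ### The permanent at `m = n`: homogeneous split and dual shapes -/

section Perm

/-- `per_n` is its own degree-`n` component. [folklore] -/
theorem homogeneousComponent_perPoly_self (n : ℕ) :
    homogeneousComponent n (perPoly (Fin n) ℂ) = perPoly (Fin n) ℂ := by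
  have h := perPoly_isHomogeneous (n := Fin n) (k := ℂ)
  rw [Fintype.card_fin] at h
  rw [homogeneousComponent_eq_of_isHomogeneous h, if_pos rfl]

/-- **Split shape at `m = n`, homogenized:** `per_n = α det A + β det B` with `A`, `B` affine `n × n`
gives the same identity for the matrices of linear parts. [folklore] -/
theorem splitRepr_homogeneous {n : ℕ} (h : SplitRepr n n) :
    ∃ (α β : ℂ) (A B : AffMat n n), (∀ i j, (A i j).IsHomogeneous 1) ∧
      (∀ i j, (B i j).IsHomogeneous 1) ∧
        perPoly (Fin n) ℂ = MvPolynomial.C α * A.det + MvPolynomial.C β * B.det := by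
  obtain ⟨α, β, A, B, hA, hB, hper⟩ := h
  refine ⟨α, β, A.map (homogeneousComponent 1), B.map (homogeneousComponent 1),
    isHomogeneous_map_homogeneousComponent_one A, isHomogeneous_map_homogeneousComponent_one B, ?_⟩
  have h := congrArg (homogeneousComponent n) hper
  rwa [homogeneousComponent_perPoly_self, map_add, homogeneousComponent_C_mul,
    homogeneousComponent_C_mul, homogeneousComponent_det_fin A hA,
    homogeneousComponent_det_fin B hB] at h

/-- **Dual shape at `m = n`, homogenized:** `per_n = α det A + β tr(adj A · B)` with `A`, `B` affine
`n × n` gives the same identity for the matrices of linear parts. [folklore] -/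
theorem dualRepr_homogeneous {n : ℕ} (h : DualRepr n n) :
    ∃ (α β : ℂ) (A B : AffMat n n), (∀ i j, (A i j).IsHomogeneous 1) ∧
      (∀ i j, (B i j).IsHomogeneous 1) ∧
        perPoly (Fin n) ℂ =
          MvPolynomial.C α * A.det + MvPolynomial.C β * (A.adjugate * B).trace := by
  obtain ⟨α, β, A, B, hA, hB, hper⟩ := h
  refine ⟨α, β, A.map (homogeneousComponent 1), B.map (homogeneousComponent 1),
    isHomogeneous_map_homogeneousComponent_one A, isHomogeneous_map_homogeneousComponent_one B, ?_⟩
  have h := congrArg (homogeneousComponent n) hper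
  rwa [homogeneousComponent_perPoly_self, map_add, homogeneousComponent_C_mul,
    homogeneousComponent_C_mul, homogeneousComponent_det_fin A hA,
    homogeneousComponent_trace_adjugate_mul A B hA hB] at h

/-- The origin is a common zero of `per_n` (`n ≥ 1`) and of the determinant of any `n × n` matrix of
linear forms. [folklore] -/
theorem exists_common_zero_of_isHomogeneous_one {n : ℕ} (hn : 1 ≤ n) (A : AffMat n n)
    (hA : ∀ i j, (A i j).IsHomogeneous 1) :
    ∃ p : Fin n × Fin n → ℂ, eval p (perPoly (Fin n) ℂ) = 0 ∧ eval p A.det = 0 := by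
  refine ⟨0, ?_, ?_⟩
  · rw [MvPolynomial.eval_zero]
    exact constantCoeff_perPoly ℂ hn
  · rw [MvPolynomial.eval_zero]
    exact constantCoeff_det_eq_zero_of_isHomogeneous_one hn A hA

/-- **No `(n, ≤ 2)`-representation of `per_n` for large `n`** (`HasDim2Repr` form).  After
`stub_classify` and homogenization, the origin is a common zero of `per_n` and `det A`; the proved
`HessianRankCodimTwo` gives a common zero `p` with `n² < 2·rank Hess per_n(p)`, and the rank is
`≤ 4n` (split) resp. `≤ 6n` (dual): so `n < 12`. [folklore] -/
theorem not_hasDim2Repr_self : ∃ n₀ : ℕ, ∀ n ≥ n₀, ¬ HasDim2Repr n n := by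
  obtain ⟨nH, hH⟩ :=
    Summit.ValiantsHypothesis.ValiantsHypothesis.Theorems.GrenetZeonHessianRankCodimTwo.hessianRankCodimTwo_proof
  refine ⟨max nH 12, fun n hn hrep => ?_⟩
  have hnH : nH ≤ n := (le_max_left _ _).trans hn
  have hn12 : 12 ≤ n := (le_max_right _ _).trans hn
  have hn1 : 1 ≤ n := by omega
  rcases stub_classify n n hrep with hS | hD
  · obtain ⟨α, β, A, B, hA, hB, hper⟩ := splitRepr_homogeneous hS
    have hA' : IsAffine A := fun i j => totalDegree_le_one_of_isHomogeneous_one (hA i j)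
    have hB' : IsAffine B := fun i j => totalDegree_le_one_of_isHomogeneous_one (hB i j)
    obtain ⟨p, hp, hpA, hrank⟩ := hH n hnH A.det (exists_common_zero_of_isHomogeneous_one hn1 A hA)
    have hle := SplitCase.rank_hess0_transl_perPoly_le_of_split hA' hB' hper p hp hpA
    have h1 : n ^ 2 < 2 * (4 * n) := lt_of_lt_of_le hrank (Nat.mul_le_mul_left 2 hle)
    nlinarith
  · obtain ⟨α, β, A, B, hA, hB, hper⟩ := dualRepr_homogeneous hD
    have hA' : IsAffine A := fun i j => totalDegree_le_one_of_isHomogeneous_one (hA i j)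
    have hB' : IsAffine B := fun i j => totalDegree_le_one_of_isHomogeneous_one (hB i j)
    obtain ⟨p, hp, hpA, hrank⟩ := hH n hnH A.det (exists_common_zero_of_isHomogeneous_one hn1 A hA)
    have hle := DualCase.rank_hess0_transl_perPoly_le_of_dual hA' hB' hper p hp hpA
    have h1 : n ^ 2 < 2 * (6 * n) := lt_of_lt_of_le hrank (Nat.mul_le_mul_left 2 hle)
    nlinarith

/-- **THE `(n, 2)` CORNER IS EMPTY.** For all large `n`, the permanent `per_n` has no
`(n, 2)`-representation: no `n × n` affine matrix over a two-dimensional commutative `ℂ`-algebra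
(`ℂ × ℂ`: `per_n = α det A + β det B`; `ℂ[ε]/ε²`: `per_n = α det A + β tr(adj A · B)`) has `per_n` as a
linear functional of its determinant.  (`HasDim2Repr n m` is `HasAlgDetRepr (perPoly (Fin n) ℂ) m 2`
verbatim.) [folklore] -/
theorem not_hasAlgDetRepr_perPoly_self_two :
    ∃ n₀ : ℕ, ∀ n ≥ n₀, ¬ HasAlgDetRepr (perPoly (Fin n) ℂ) n 2 :=
  not_hasDim2Repr_self

/-- Monotone form: no `(m, s)`-representation with `m ≤ n` and `s ≤ 2` for large `n` (sizes `m < n`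
are excluded by the degree floor through `HasAlgDetRepr.mono`, which pads `m` up to `n`). [folklore] -/
theorem not_hasAlgDetRepr_perPoly_of_le_self_two :
    ∃ n₀ : ℕ, ∀ n ≥ n₀, ∀ m s : ℕ, m ≤ n → s ≤ 2 → ¬ HasAlgDetRepr (perPoly (Fin n) ℂ) m s := by
  obtain ⟨n₀, h⟩ := not_hasAlgDetRepr_perPoly_self_two
  exact ⟨n₀, fun n hn m s hm hs hrep => h n hn (hrep.mono hm hs)⟩

/-- **`TwoDimCoefficients` at `m = n`, unconditionally** (crux stmt-ValiantsHypothesis-8062 restricted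
to the degree floor): vacuously, with any constant, since no `(n, ≤ 2)`-representation exists for
large `n` — the unit case `det A ≡ c ≠ 0` of that crux never arises for a homogeneous witness.
[folklore] -/
theorem twoDimCoefficients_self :
    ∃ n₀ : ℕ, ∀ n ≥ n₀, ∀ C : ℕ, HasDim2Repr n n → n ^ 2 ≤ C * n := by
  obtain ⟨n₀, h⟩ := not_hasDim2Repr_self
  exact ⟨n₀, fun n hn C hrep => absurd hrep (h n hn)⟩

/-- **Reading for the piece `PolySizeQPAlgebra` (stmt-8064), `c = 1` box:** the point
`(m, s) = (n, 2)` (inside the box: `n ≤ n^1 + 1`, `2 ≤ 2^((log₂ n + 1)^1)` for `n ≥ 1`) carries no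
representation of `per_n` for large `n` — in the verbatim `∃ R …` form of the piece. [folklore] -/
theorem polySizeQPAlgebra_one_point_two :
    ∃ n₀ : ℕ, ∀ n ≥ n₀, ¬ (∃ (R : Type) (_ : CommRing R) (_ : Algebra ℂ R) (_ : Module.Finite ℂ R),
      Module.finrank ℂ R ≤ 2 ∧ ∃ (l : R →ₗ[ℂ] ℂ)
        (A : Matrix (Fin n) (Fin n) (MvPolynomial (Fin n × Fin n) R)),
        (∀ i j, (A i j).totalDegree ≤ 1) ∧ ∀ d : (Fin n × Fin n) →₀ ℕ,
          l (MvPolynomial.coeff d A.det) = MvPolynomial.coeff d (perPoly (Fin n) ℂ)) :=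
  not_hasAlgDetRepr_perPoly_self_two

end Perm

end Summit.ValiantsHypothesis.ValiantsHypothesis.Theorems.GrenetZeonPolySizeQPAlgebra

end
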